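import Summits.NavierStokesRegularity.NavierStokesRegularity.Theorems.ExtremiserTransienceNearExtremalTransienceExtremiserLiouvilleConstantSpeedBlowDownPairing
import Literature.Analysis.FluidPDE.TaoEnstrophyLocalisation
import Mathlib.Analysis.Calculus.ContDiff.Bounds
import Mathlib.Analysis.SpecialFunctions.JapaneseBracket
import HarnessLib

/-!
# Crux `ExtremiserTransience.NearExtremalTransience` (stmt-NavierStokesRegularity-21883), line `extremiser_liouville`,
# stub K1b — TOOLS: `ρ`-uniform envelopes of the solenoidal truncations `curl(χ_ρ A)` of a decaying vector potential

`--supports stmt-NavierStokesRegularity-21883` (helper).  Author: prover seat `ns-el-k1b` (g6).  Tools for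
`…ConstantSpeedMultiplierExtension` (g3's multiplier identity extended to decaying test fields `φ = curl A`): for
`A ∈ C^∞(ℝ³;ℝ³)` with `‖A(x)‖ ≤ C(1+‖x‖)⁻¹`, `‖DᵏA(x)‖ ≤ C(1+‖x‖)⁻²` (`k = 1,2,3`) — the class of Newtonian vector potentials
`A = Γ ∗ B`, `B ∈ C_c^∞` — the truncations `χ_ρ A` (`χ_ρ` the tree's `cutoff ρ`) obey `‖Dᵏ(χ_ρ A)(x)‖ ≤ 8cC(1+‖x‖)⁻²`
uniformly in `ρ ≥ 1`.

* `exists_norm_iteratedFDeriv_cutoff_le` : `‖Dⁱ χ_ρ (x)‖ ≤ c (1+‖x‖)^{-i}`, `i ≤ 3`, uniformly in `ρ ≥ 1` (chain rule + support).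
* `norm_iteratedFDeriv_cutoff_smul_le` : the Leibniz envelope `‖Dᵏ(χ_ρ A)(x)‖ ≤ 8 c C (1+‖x‖)⁻²`, `k = 1,2,3`.
* `norm_iteratedFDeriv_curl_le` : `‖Dⁱ curl F‖ ≤ ‖curlCLM‖ ‖Dⁱ⁺¹F‖`; `eqOn_fderiv_curl_of_isOpen`.
* `rescale_decay` : `x ↦ R·A(R⁻¹x)` stays in the class (constant `C R³`) and `curl(R·A(R⁻¹·)) = (curl A)(R⁻¹·)`.

WHAT THIS IS NOT: K1b is NOT proved; nothing here proves NS regularity. [folklore]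
-/

noncomputable section

open Set Filter Topology MeasureTheory Metric Function
open scoped ENNReal NNReal Topology InnerProductSpace RealInnerProductSpace ContDiff
open Literature.Analysis.FluidPDE Literature.Analysis

namespace Summit.NavierStokesRegularity.NavierStokesRegularity.Theorems

-- the problem directory repeats the summit name (`NavierStokesRegularity/NavierStokesRegularity`)
set_option linter.dupNamespace false

namespace ExtremiserLiouville

open DepletionLadder.KStar DepletionLadder.KStar.HalfSpace
open Summit.NavierStokesRegularity.NavierStokesRegularity.Theorems.RungReynoldsOne.WeightedSlice

/-! ## Derivatives of the cutoff `χ_ρ = cutoff ρ`, uniformly in `ρ ≥ 1` -/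

/-- `tsupport (cutoff ρ) ⊆ B̄(0, 2ρ)` (`ρ > 0`). [folklore] -/
theorem tsupport_cutoff_subset {ρ : ℝ} (hρ : 0 < ρ) : tsupport (cutoff (E := E3) ρ) ⊆ closedBall (0 : E3) (2 * ρ) := by
  refine closure_minimal (fun x hx => ?_) isClosed_closedBall
  rw [mem_closedBall, dist_zero_right]
  by_contra h
  exact hx (cutoff_eq_zero hρ (not_le.1 h).le)

/-- **Uniform bounds for the derivatives of the cutoff**: there is `c ≥ 1` with
`‖Dⁱ(cutoff ρ)(x)‖ ≤ c (1+‖x‖)^{-i}` for all `ρ ≥ 1`, `i ≤ 3`, `x` (chain rule `Dⁱ(χ(·/ρ)) = ρ^{-i}(Dⁱχ)(·/ρ)`, the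
derivatives of `χ` are bounded, and `Dⁱ(cutoff ρ)` is supported in `‖x‖ ≤ 2ρ`, where `1 + ‖x‖ ≤ 3ρ`). [folklore] -/
theorem exists_norm_iteratedFDeriv_cutoff_le :
    ∃ c : ℝ, 1 ≤ c ∧ ∀ ρ : ℝ, 1 ≤ ρ → ∀ i : ℕ, i ≤ 3 → ∀ x : E3,
      ‖iteratedFDeriv ℝ i (cutoff (E := E3) ρ) x‖ ≤ c * ((1 + ‖x‖) ^ i)⁻¹ := by
  set χ : ContDiffBump (0 : E3) := FunctionSpaces.dyadicCutoff E3 with hχ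
  -- bounds for the derivatives of `χ`
  have hb : ∀ i : ℕ, ∃ b : ℝ, 0 ≤ b ∧ ∀ y : E3, ‖iteratedFDeriv ℝ i (χ : E3 → ℝ) y‖ ≤ b := fun i => by
    obtain ⟨b, hb⟩ := (χ.contDiff.continuous_iteratedFDeriv (m := i) (by exact_mod_cast le_top)).bounded_above_of_compact_support
      (χ.hasCompactSupport.iteratedFDeriv (𝕜 := ℝ) i)
    exact ⟨max b 0, le_max_right _ _, fun y => (hb y).trans (le_max_left _ _)⟩
  choose b hb0 hb using hb
  set c₀ : ℝ := b 0 + b 1 + b 2 + b 3 with hc₀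
  have hbc : ∀ i, i ≤ 3 → b i ≤ c₀ := fun i hi => by
    interval_cases i <;> linarith [hb0 0, hb0 1, hb0 2, hb0 3]
  have hc₀0 : 0 ≤ c₀ := by simp only [hc₀]; linarith [hb0 0, hb0 1, hb0 2, hb0 3]
  refine ⟨27 * c₀ + 1, by linarith, fun ρ hρ i hi x => ?_⟩
  have hρ0 : 0 < ρ := lt_of_lt_of_le one_pos hρ
  have hx1 : 0 < 1 + ‖x‖ := by positivity
  by_cases hx : ‖x‖ ≤ 2 * ρ
  · -- chain rule with the linear map `y ↦ ρ⁻¹ y`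
    set L : E3 →L[ℝ] E3 := ρ⁻¹ • ContinuousLinearMap.id ℝ E3 with hL
    have hcomp : cutoff (E := E3) ρ = (χ : E3 → ℝ) ∘ L := by
      funext y; simp [cutoff_apply, hL, hχ]
    have hLn : ‖L‖ ≤ ρ⁻¹ := by
      rw [hL, norm_smul, Real.norm_eq_abs, abs_of_pos (inv_pos.2 hρ0)]
      exact mul_le_of_le_one_right (inv_pos.2 hρ0).le ContinuousLinearMap.norm_id_le
    have h1 : ‖iteratedFDeriv ℝ i (cutoff (E := E3) ρ) x‖ ≤ b i * ρ⁻¹ ^ i := by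
      rw [hcomp, ContinuousLinearMap.iteratedFDeriv_comp_right L (χ.contDiff (n := i)) x (by exact_mod_cast le_rfl)]
      refine (ContinuousMultilinearMap.norm_compContinuousLinearMap_le _ _).trans ?_
      rw [Finset.prod_const, Finset.card_univ, Fintype.card_fin]
      exact mul_le_mul (hb i _) (pow_le_pow_left₀ (norm_nonneg _) hLn i) (by positivity) (hb0 i)
    -- `ρ⁻¹ ≤ 3 (1 + ‖x‖)⁻¹`
    have h2 : ρ⁻¹ ^ i ≤ 3 ^ i * ((1 + ‖x‖) ^ i)⁻¹ := by
      rw [← inv_pow, ← mul_pow]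
      refine pow_le_pow_left₀ (inv_pos.2 hρ0).le ?_ i
      rw [← div_eq_mul_inv, le_div_iff₀ hx1]
      have : 1 + ‖x‖ ≤ 3 * ρ := by linarith
      calc ρ⁻¹ * (1 + ‖x‖) ≤ ρ⁻¹ * (3 * ρ) := mul_le_mul_of_nonneg_left this (inv_pos.2 hρ0).le
        _ = 3 := by field_simp
    have h3 : (3 : ℝ) ^ i ≤ 27 := by
      interval_cases i <;> norm_num
    calc ‖iteratedFDeriv ℝ i (cutoff (E := E3) ρ) x‖ ≤ b i * ρ⁻¹ ^ i := h1
      _ ≤ c₀ * (3 ^ i * ((1 + ‖x‖) ^ i)⁻¹) := mul_le_mul (hbc i hi) h2 (by positivity) hc₀0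
      _ = (3 ^ i * c₀) * ((1 + ‖x‖) ^ i)⁻¹ := by ring
      _ ≤ (27 * c₀ + 1) * ((1 + ‖x‖) ^ i)⁻¹ := by
          refine mul_le_mul_of_nonneg_right ?_ (by positivity)
          nlinarith [h3, hc₀0]
  · -- off the support
    have hx' : x ∉ tsupport (cutoff (E := E3) ρ) := fun h => hx (by
      have := tsupport_cutoff_subset hρ0 h
      rwa [mem_closedBall, dist_zero_right] at this)
    have h0 : iteratedFDeriv ℝ i (cutoff (E := E3) ρ) x = 0 := by
      by_contra h
      exact hx' (support_iteratedFDeriv_subset i (mem_support.2 h))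
    rw [h0, norm_zero]
    positivity

/-! ## The envelope of the truncations `χ_ρ A` -/

variable {A : E3 → E3}

/-- `(t^m)⁻¹ ≤ (t^2)⁻¹` for `t ≥ 1`, `m ≥ 2`. [folklore] -/
theorem inv_pow_le_inv_sq {t : ℝ} (ht : 1 ≤ t) {m : ℕ} (hm : 2 ≤ m) : (t ^ m)⁻¹ ≤ (t ^ 2)⁻¹ :=
  inv_anti₀ (by positivity) (pow_le_pow_right₀ ht hm)

/-- **Envelope**: for `A` smooth with `‖A(x)‖ ≤ C(1+‖x‖)⁻¹`, `‖DᵏA(x)‖ ≤ C(1+‖x‖)⁻²` (`k = 1,2,3`), and `c` the cutoff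
constant: `‖Dᵏ(χ_ρ A)(x)‖ ≤ 8 c C (1+‖x‖)⁻²` for `k = 1, 2, 3`, all `ρ ≥ 1`, all `x` (Leibniz). [folklore] -/
theorem norm_iteratedFDeriv_cutoff_smul_le (hA : ContDiff ℝ ∞ A) {C : ℝ}
    (hA0 : ∀ x, ‖A x‖ ≤ C * (1 + ‖x‖)⁻¹)
    (hAk : ∀ k : ℕ, 1 ≤ k → k ≤ 3 → ∀ x, ‖iteratedFDeriv ℝ k A x‖ ≤ C * ((1 + ‖x‖) ^ 2)⁻¹)
    {c : ℝ} (hc1 : 1 ≤ c)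
    (hc : ∀ ρ : ℝ, 1 ≤ ρ → ∀ i : ℕ, i ≤ 3 → ∀ x : E3, ‖iteratedFDeriv ℝ i (cutoff (E := E3) ρ) x‖ ≤ c * ((1 + ‖x‖) ^ i)⁻¹)
    {ρ : ℝ} (hρ : 1 ≤ ρ) {k : ℕ} (hk1 : 1 ≤ k) (hk3 : k ≤ 3) (x : E3) :
    ‖iteratedFDeriv ℝ k (fun y => cutoff ρ y • A y) x‖ ≤ 8 * c * C * ((1 + ‖x‖) ^ 2)⁻¹ := by
  have hC0 : 0 ≤ C := by
    have h := hA0 0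
    have : 0 < (1 + ‖(0 : E3)‖)⁻¹ := by positivity
    nlinarith [norm_nonneg (A 0)]
  have ht : 1 ≤ 1 + ‖x‖ := by linarith [norm_nonneg x]
  set t : ℝ := 1 + ‖x‖ with htdef
  have ht0 : 0 < t := by positivity
  -- the `A`-factor with a unified exponent
  have hAj : ∀ j : ℕ, j ≤ 3 → ‖iteratedFDeriv ℝ j A x‖ ≤ C * (t ^ (min j 1 + 1))⁻¹ := by
    intro j hj
    rcases Nat.eq_zero_or_pos j with h0 | hpos
    · subst h0
      rw [norm_iteratedFDeriv_zero]
      simpa [htdef] using hA0 x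
    · have : min j 1 + 1 = 2 := by rw [min_eq_right hpos]
      rw [this]; exact hAk j hpos hj x
  have hle := norm_iteratedFDeriv_smul_le (contDiff_cutoff ρ : ContDiff ℝ ∞ (cutoff (E := E3) ρ)) hA x (n := k)
    (by exact_mod_cast le_top)
  refine hle.trans ?_
  have hterm : ∀ i ∈ Finset.range (k + 1),
      (k.choose i : ℝ) * ‖iteratedFDeriv ℝ i (cutoff ρ) x‖ * ‖iteratedFDeriv ℝ (k - i) A x‖ ≤
        (k.choose i : ℝ) * (c * C * (t ^ 2)⁻¹) := by
    intro i hi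
    have hik : i ≤ k := Nat.lt_succ_iff.1 (Finset.mem_range.1 hi)
    have hi3 : i ≤ 3 := hik.trans hk3
    have h1 := hc ρ hρ i hi3 x
    have h2 := hAj (k - i) (by omega)
    have hexp : 2 ≤ i + (min (k - i) 1 + 1) := by
      rcases Nat.lt_or_ge (k - i) 1 with h | h
      · have : k - i = 0 := by omega
        rw [this]; omega
      · rw [min_eq_right h]; omega
    have h3 : (t ^ i)⁻¹ * (t ^ (min (k - i) 1 + 1))⁻¹ ≤ (t ^ 2)⁻¹ := by
      rw [← mul_inv, ← pow_add]
      exact inv_pow_le_inv_sq ht hexp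
    rw [mul_assoc]
    refine mul_le_mul_of_nonneg_left ?_ (by positivity)
    calc ‖iteratedFDeriv ℝ i (cutoff ρ) x‖ * ‖iteratedFDeriv ℝ (k - i) A x‖
        ≤ (c * (t ^ i)⁻¹) * (C * (t ^ (min (k - i) 1 + 1))⁻¹) :=
          mul_le_mul h1 h2 (norm_nonneg _) (by positivity)
      _ = c * C * ((t ^ i)⁻¹ * (t ^ (min (k - i) 1 + 1))⁻¹) := by ring
      _ ≤ c * C * (t ^ 2)⁻¹ := mul_le_mul_of_nonneg_left h3 (by positivity)
  refine (Finset.sum_le_sum hterm).trans ?_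
  rw [← Finset.sum_mul]
  have hsum : ∑ i ∈ Finset.range (k + 1), (k.choose i : ℝ) = 2 ^ k := by
    have h := Nat.sum_range_choose k
    exact_mod_cast h
  rw [hsum]
  have h2k : (2 : ℝ) ^ k ≤ 8 := by
    interval_cases k <;> norm_num
  have : 0 ≤ c * C * (t ^ 2)⁻¹ := by positivity
  nlinarith [h2k, this]


/-! ## Envelopes for `curl`-derivatives and local agreement -/

/-- `‖Dⁱ(curl F)(x)‖ ≤ ‖curlCLM‖ · ‖Dⁱ⁺¹F(x)‖` (`curl = curlCLM ∘ D`). [folklore] -/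
theorem norm_iteratedFDeriv_curl_le {F : E3 → E3} (hF : ContDiff ℝ ∞ F) (i : ℕ) (x : E3) :
    ‖iteratedFDeriv ℝ i (curl F) x‖ ≤ ‖curlCLM‖ * ‖iteratedFDeriv ℝ (i + 1) F x‖ := by
  have hDF : ContDiff ℝ ∞ (fderiv ℝ F) := (contDiff_infty_iff_fderiv.1 hF).2
  rw [curl_eq_curlCLM_comp, ContinuousLinearMap.iteratedFDeriv_comp_left curlCLM (hDF.contDiffAt (x := x))
    (by exact_mod_cast le_top), ← norm_iteratedFDeriv_fderiv]
  exact ContinuousLinearMap.norm_compContinuousMultilinearMap_le _ _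

/-- `‖f x‖ = ‖D⁰f x‖` and `‖Df x‖ = ‖D¹f x‖` (norms of the first two iterated derivatives). [folklore] -/
theorem norm_fderiv_eq_norm_iteratedFDeriv_one {F : E3 → E3} (x : E3) :
    ‖fderiv ℝ F x‖ = ‖iteratedFDeriv ℝ 1 F x‖ := by
  rw [← norm_iteratedFDeriv_fderiv, norm_iteratedFDeriv_zero]

/-- Equality on an open set passes to `fderiv` and `curl`. [folklore] -/
theorem eqOn_fderiv_curl_of_isOpen {f g : E3 → E3} {U : Set E3} (hU : IsOpen U) (h : EqOn f g U) :
    EqOn (fderiv ℝ f) (fderiv ℝ g) U ∧ EqOn (curl f) (curl g) U := by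
  have hD : EqOn (fderiv ℝ f) (fderiv ℝ g) U := fun y hy =>
    (Filter.eventuallyEq_of_mem (hU.mem_nhds hy) h).fderiv_eq
  exact ⟨hD, fun y hy => by rw [curl_eq_curlCLM, curl_eq_curlCLM, hD hy]⟩

/-! ## The rescaled fields `(curl A)(R⁻¹·)` -/

/-- The rescaled potential `x ↦ R·A(R⁻¹x)` stays in the decay class (constant `C R³`, `R ≥ 1`), and its curl is the
rescaled field `(curl A)(R⁻¹·)`. [folklore] -/
theorem rescale_decay (hA : ContDiff ℝ ∞ A) {C : ℝ} (hA0 : ∀ x, ‖A x‖ ≤ C * (1 + ‖x‖)⁻¹)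
    (hAk : ∀ k : ℕ, 1 ≤ k → k ≤ 3 → ∀ x, ‖iteratedFDeriv ℝ k A x‖ ≤ C * ((1 + ‖x‖) ^ 2)⁻¹) {R : ℝ} (hR : 1 ≤ R) :
    ContDiff ℝ ∞ (fun x => R • A (R⁻¹ • x)) ∧ (∀ x, ‖R • A (R⁻¹ • x)‖ ≤ C * R ^ 3 * (1 + ‖x‖)⁻¹) ∧
      (∀ k : ℕ, 1 ≤ k → k ≤ 3 → ∀ x, ‖iteratedFDeriv ℝ k (fun x => R • A (R⁻¹ • x)) x‖ ≤ C * R ^ 3 * ((1 + ‖x‖) ^ 2)⁻¹) ∧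
      curl (fun x => R • A (R⁻¹ • x)) = fun x => curl A (R⁻¹ • x) := by
  have hR0 : 0 < R := lt_of_lt_of_le one_pos hR
  have hRinv : 0 < R⁻¹ := inv_pos.2 hR0
  have hC0 : 0 ≤ C := by
    have h := hA0 0
    have : 0 < (1 + ‖(0 : E3)‖)⁻¹ := by positivity
    nlinarith [norm_nonneg (A 0)]
  set L : E3 →L[ℝ] E3 := R⁻¹ • ContinuousLinearMap.id ℝ E3 with hL
  have hLn : ‖L‖ ≤ R⁻¹ := by
    rw [hL, norm_smul, Real.norm_eq_abs, abs_of_pos hRinv]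
    exact mul_le_of_le_one_right hRinv.le ContinuousLinearMap.norm_id_le
  have hcomp : (fun x => A (R⁻¹ • x)) = A ∘ L := by funext y; simp [hL]
  have hAL : ContDiff ℝ ∞ (fun x => A (R⁻¹ • x)) := by rw [hcomp]; exact hA.comp L.contDiff
  have hsm : ContDiff ℝ ∞ (fun x => R • A (R⁻¹ • x)) := hAL.const_smul R
  -- the weight `(1 + ‖R⁻¹x‖)⁻¹ ≤ R (1 + ‖x‖)⁻¹`
  have hw : ∀ x : E3, ∀ m : ℕ, m ≤ 2 → ((1 + ‖R⁻¹ • x‖) ^ m)⁻¹ ≤ R ^ 2 * ((1 + ‖x‖) ^ m)⁻¹ := by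
    intro x m hm
    have hx : 0 < 1 + ‖x‖ := by positivity
    have h1 : 1 + ‖x‖ ≤ R * (1 + ‖R⁻¹ • x‖) := by
      rw [norm_smul, Real.norm_eq_abs, abs_of_pos hRinv, mul_add, mul_one, ← mul_assoc, mul_inv_cancel₀ hR0.ne', one_mul]
      linarith [norm_nonneg x]
    have h2 : (1 + ‖x‖) ^ m ≤ R ^ m * (1 + ‖R⁻¹ • x‖) ^ m := by
      rw [← mul_pow]; exact pow_le_pow_left₀ hx.le h1 m
    have h3 : R ^ m ≤ R ^ 2 := pow_le_pow_right₀ hR hm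
    have h4 : 0 < (1 + ‖R⁻¹ • x‖) ^ m := by positivity
    rw [← div_eq_mul_inv, le_div_iff₀ (by positivity)]
    calc ((1 + ‖R⁻¹ • x‖) ^ m)⁻¹ * (1 + ‖x‖) ^ m ≤ ((1 + ‖R⁻¹ • x‖) ^ m)⁻¹ * (R ^ m * (1 + ‖R⁻¹ • x‖) ^ m) :=
          mul_le_mul_of_nonneg_left h2 (by positivity)
      _ = R ^ m := by field_simp
      _ ≤ R ^ 2 := h3
  refine ⟨hsm, fun x => ?_, fun k hk1 hk3 x => ?_, ?_⟩
  · rw [norm_smul, Real.norm_eq_abs, abs_of_pos hR0]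
    have h := hA0 (R⁻¹ • x)
    have h' := hw x 1 (by norm_num)
    rw [pow_one, pow_one] at h'
    calc R * ‖A (R⁻¹ • x)‖ ≤ R * (C * (1 + ‖R⁻¹ • x‖)⁻¹) := mul_le_mul_of_nonneg_left h hR0.le
      _ ≤ R * (C * (R ^ 2 * (1 + ‖x‖)⁻¹)) := mul_le_mul_of_nonneg_left (mul_le_mul_of_nonneg_left h' hC0) hR0.le
      _ = C * R ^ 3 * (1 + ‖x‖)⁻¹ := by ring
  · have e1 : iteratedFDeriv ℝ k (fun x => R • A (R⁻¹ • x)) x = R • iteratedFDeriv ℝ k (fun x => A (R⁻¹ • x)) x :=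
      iteratedFDeriv_const_smul_apply' (hAL.contDiffAt.of_le (by exact_mod_cast le_top))
    rw [e1, norm_smul, Real.norm_eq_abs, abs_of_pos hR0, hcomp,
      ContinuousLinearMap.iteratedFDeriv_comp_right L hA x (by exact_mod_cast le_top)]
    have h2 := ContinuousMultilinearMap.norm_compContinuousLinearMap_le (iteratedFDeriv ℝ k A (L x)) fun _ => L
    rw [Finset.prod_const, Finset.card_univ, Fintype.card_fin] at h2
    have h3 : ‖L‖ ^ k ≤ 1 := pow_le_one₀ (norm_nonneg _) (hLn.trans (inv_le_one_of_one_le₀ hR))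
    have h4 : L x = R⁻¹ • x := by simp [hL]
    have h5 := hAk k hk1 hk3 (L x)
    rw [h4] at h5
    have h6 := hw x 2 le_rfl
    calc R * ‖(iteratedFDeriv ℝ k A (L x)).compContinuousLinearMap fun _ => L‖
        ≤ R * (‖iteratedFDeriv ℝ k A (L x)‖ * ‖L‖ ^ k) := mul_le_mul_of_nonneg_left h2 hR0.le
      _ ≤ R * (‖iteratedFDeriv ℝ k A (L x)‖ * 1) :=
          mul_le_mul_of_nonneg_left (mul_le_mul_of_nonneg_left h3 (norm_nonneg _)) hR0.le
      _ ≤ R * (C * (R ^ 2 * ((1 + ‖x‖) ^ 2)⁻¹)) := by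
          rw [mul_one, h4]
          exact mul_le_mul_of_nonneg_left (h5.trans (mul_le_mul_of_nonneg_left h6 hC0)) hR0.le
      _ = C * R ^ 3 * ((1 + ‖x‖) ^ 2)⁻¹ := by ring
  · funext x
    have hd : Differentiable ℝ A := hA.differentiable (by simp)
    have hdL : DifferentiableAt ℝ (fun x => A (R⁻¹ • x)) x := (hasFDerivAt_rescale hd R x).differentiableAt
    rw [show (fun x => R • A (R⁻¹ • x)) = fun x => R • (fun y => A (R⁻¹ • y)) x from rfl, curl_const_smul hdL,
      curl_rescale hd, smul_smul, mul_inv_cancel₀ hR0.ne', one_smul]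

end ExtremiserLiouville

end Summit.NavierStokesRegularity.NavierStokesRegularity.Theorems

end
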